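import Summits.BirchSwinnertonDyer.BirchSwinnertonDyer.Theorems.EdixhovenFibreFiveSevenManinSideOfCDTInt
import Summits.BirchSwinnertonDyer.BirchSwinnertonDyer.Theorems.EdixhovenFibreFiveSevenStarredOptimalManinUnitFiveSevenHcorTwoPow
import Literature.NumberTheory.Automorphic.UnboundedDenominatorsOfCor453
import HarnessLib

set_option autoImplicit false
-- the sub-problem namespace `Summit.BirchSwinnertonDyer.BirchSwinnertonDyer` duplicates a component by design (D-0017)
set_option linter.dupNamespace false

/-!
# Crux K★ `StarredOptimalManinUnitFiveSeven` (stmt-BirchSwinnertonDyer-22226) — line `cdt_thm1`, closed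

Skeleton v17 of line `cdt_thm1` (LEAD edix-p1) reduced the crux to ONE stub, the invariant form of
[CalegariDimitrovTang2025, Corollary 4.5.3]: *an `SL₂(ℤ)`-conjugation-invariant homomorphism from `Γ(N)` to a
finite abelian group is trivial on some `Γ(M)`*.  That stub is now the tree theorem
`…Theorems.HcorTwoPow.stub_hcor_invariant_all` (all levels `N`; `M = 12N`; elementary proof through the
structure of `SL₂(ℤ)/K_θ`: squarefree levels, transfer, the depth step at odd prime powers via the modular
relation, and the `2`-adic depth step via the auxiliary `ℤ/2`-character — the Schur multiplier of `SL₂(ℤ/N)`,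
[Beyl1986], never enters as a named fact).  Composition, exactly as in the skeleton:

* `calegariDimitrovTang2025_unboundedDenominators_holds` — **CDT Theorem 1.0.1 (unbounded denominators)**,
  by `CalegariDimitrovTang2025_unboundedDenominators.of_cor453_invariant` (p821622: `of_two_inputs`, Ihara's
  amalgam + CSP, `cor453_of_invariant_form`) applied to the stub theorem;
* `StarredOptimalManinUnitFiveSeven_proof` — **the crux BY NAME**, by LEAD g36's closer
  `EdixhovenFibreFiveSevenOfCDTInt.starredOptimalManinUnitFiveSeven_of_CDTInt : CDT-Thm-1 → K★` (p811415).

BSD is not proved by this; Manin's conjecture is not proved by this (only the starred types at `p ∈ {5, 7}` of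
the route's statement). [cite: CalegariDimitrovTang2025, Thm. 1.0.1, Cor. 4.5.3] [cite: EdixhovenManin1991, Thm. 3]
-/

namespace Summit.BirchSwinnertonDyer.BirchSwinnertonDyer.Theorems

open Literature.NumberTheory.Automorphic Literature.NumberTheory.Automorphic.UnboundedDenominators

/-- **CDT Theorem 1.0.1 (the unbounded denominators conjecture) holds**: the named fact
`CalegariDimitrovTang2025_unboundedDenominators`, discharged from its reduction to Corollary 4.5.3 in invariant
form (`of_cor453_invariant`) and the tree proof of that invariant form for all levels
(`HcorTwoPow.stub_hcor_invariant_all`). [cite: CalegariDimitrovTang2025, Thm. 1.0.1 and Cor. 4.5.3] -/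
theorem calegariDimitrovTang2025_unboundedDenominators_holds : CalegariDimitrovTang2025_unboundedDenominators :=
  CalegariDimitrovTang2025_unboundedDenominators.of_cor453_invariant HcorTwoPow.stub_hcor_invariant_all

/-- **Crux K★ `StarredOptimalManinUnitFiveSeven` (stmt-BirchSwinnertonDyer-22226), proved by name**: the starred
Kodaira types IV*, III*, II* at `p ∈ {5, 7}` with `E[p]` irreducible and a lattice-optimal conductor-level datum
have `p ∤ c` — from CDT Theorem 1.0.1 (`calegariDimitrovTang2025_unboundedDenominators_holds`) through
`EdixhovenFibreFiveSevenOfCDTInt.starredOptimalManinUnitFiveSeven_of_CDTInt`.  BSD is NOT proved by this.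
[cite: CalegariDimitrovTang2025, Thm. 1.0.1] [cite: EdixhovenManin1991, Thm. 3] -/
theorem StarredOptimalManinUnitFiveSeven_proof :
    Summit.BirchSwinnertonDyer.BirchSwinnertonDyer.Theses.EdixhovenFibreFiveSeven.StarredOptimalManinUnitFiveSeven :=
  EdixhovenFibreFiveSevenOfCDTInt.starredOptimalManinUnitFiveSeven_of_CDTInt
    calegariDimitrovTang2025_unboundedDenominators_holds

end Summit.BirchSwinnertonDyer.BirchSwinnertonDyer.Theorems
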